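import Summits.QuantumFields.YangMills.Theorems.UnitScaleGibbsTruncatedPotentialCollarMass
import Summits.QuantumFields.YangMills.Theorems.UnitScaleGibbsTestFieldSU2DressingPush
import Literature.MathematicalPhysics.QuantumFieldTheory.Balaban1983to89.T3ContinuumYM3Torus
import HarnessLib

/-!
# `GrossTransferStubLinTestCollarFloorRow` — ROW (R7) «COLLAR FLOOR» OF `stub_linTest`'s KNIT-E2 SKELETON AS A ROW LEMMA:
# `n·Σ_b ω b ≤ 9072·370440²·(C₁+C₂)²·L^j` (LINE 28 «GrossTransfer»; crux `UnitScaleTilt.HistoryTailL` stmt-QuantumFields-19936 ∕ `MeanDeviationL` stmt-QuantumFields-23083)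

Cell `ym3-torus` (YM ladder rung R3 = continuum SU(2) Yang–Mills on every three-torus — a RUNG, NOT d = 4, NOT infinite volume, NOT a mass gap, NOT the Clay problem); width seat
`ym3-torus-px13` gen 11, on the pen of record's dispatch (★ym-ust-19936-w2 g15 2026-08-29T22:39:55Z «(R7-row) → any idle width … SHAPE: `(n:ℝ)·Σ_b ω b ≤ C7(L)·L^j` with `ω` = push of
`(y,ν) ↦ 192·W·|δσ y ν|`, `W = Σ_{Q_{3R+1}}Σ_ν|δσ|` …»).  THEOREMS ONLY (0 `def`, default heartbeats).  The KNIT-E2 skeleton (`GrossTransferStubLinTestPointwisePackage`, HOME 518992d1,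
pen w2) fixes inside `main_estimate` the member, the dressing box `[lo, hi]`, the cone read-out `wt` on `box z₀ R₀`, its half-Green potential `βt`, `at' = δ₂βt`, `γt = d₂βt`, the
cutoff `χ` of ✓`exists_smooth_cutoff z₀ (R := R)`, the commutators `E1`, `C2`, `σ = E1 − C2`, `δσ`, the collar mass `W` and the bond weights `ω` (push of `192·W·|δσ|`); this file takes
those letters as BINDERS with their defining hypotheses VERBATIM and proves the (R7) bullet's goal shape, the size rows (`N`, `R ≤ 2N`, `N + R₀ + 4 ≤ R`, `12·L^{3j} ≤ R`, `M₀ ≤ 9(L²)^j`)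
displayed for the pen to discharge (as for ✓∕⧗`GrossTransferStubLinTestEnergyMassRows.energy_row_le`).

THE PROOF.  `Σ_b ω b ≤ 192·W·Σ_{x ∈ dressing box}Σ_ν|δσ x ν|` (push read-out, ✓`sum_pbond_eq_sum_box` ∕ ✓`push_eq_zero_of_not_le`); BOTH `δσ`-sums are instances of the `ℤ³` collar
row ✓`UnitScaleGibbsTruncatedPotentialCollarMass.collarMass_le_far'` (ym-ust-19936-w3 g18: `δ₂E₁`, `δ₂C₂` live in `box z₀ (3R+2)`, vanish on `box z₀ (R−2)`, far field in
between) after the split `|δσ| ≤ |δ₂E₁| + |δ₂C₂|`: `≤ (6R+5)³·(135∕2)·((2∕R)(C₂∕N³) + (4∕R²)(C₁∕N²))·M₀ ≤ (6R+5)³·1080(C₁+C₂)M₀∕R⁴` (`R ≤ 2N`) ⇒ `W, Σ|δσ| ≤ 370440·(C₁+C₂)·M₀∕R` ⇒ `n·Σ_b ω b ≤ (6R+6)·192·(370440(C₁+C₂)M₀∕R)² ≤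
1344·370440²(C₁+C₂)²·M₀²∕R ≤ 9072·370440²·(C₁+C₂)²·L^j` (`M₀ ≤ 9L^{2j}`, `12L^{3j} ≤ R`) — the located `O(M₀²∕R) = O(L^j)`.

WHAT IS PROVED (ns `…Theorems.GrossTransferStubLinTestCollarFloorRow`; the `ℤ³` row is ✓`…TruncatedPotentialCollarMass.collarMass_le_far'`, w3-19936 g18): §1 `sum_push_le_sum_box` (a non-negative push is read out from above on the box); §2 `collar_arith` ∕ `row_arith`
(the two real-arithmetic steps); §3 ★★★ `sum_omega_le` (`Σ_b ω b ≤ 192·(370440(C₁+C₂)M∕R)²`, `M` any bound of `M₀`) and ★★★ `collarFloor_row_le` (the bullet: `n·Σ_b ω b ≤ 9072·370440²·(C₁+C₂)²·(F.L)^j`).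
HONEST SCOPE: bookkeeping over landed `ℤ³` rows and the push dictionary; nothing of `stub_linTest`, 23083, 19936 or any summit statement is proved.  References: Balaban, CMP 96 (1984)
[Balaban1984PropagatorsII] (1.9) p.226; Gross, CMP 92 (1983) [GrossCMP1983] Thm 2.2 (the test-field floor the weights serve).
-/

set_option autoImplicit false

open scoped BigOperators
open Finset
open Literature.Probability.LatticeModels (latticeGreen)
open Literature.MathematicalPhysics.QuantumFieldTheory.Balaban1983to89
open Literature.MathematicalPhysics.QuantumFieldTheory.Balaban1983to89.T3ContinuumYM3Torus
open Literature.MathematicalPhysics.QuantumFieldTheory.Balaban1983to89.B4Eq19LatticeOperators (Zd unitVec box mem_box card_box)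
open Literature.MathematicalPhysics.QuantumFieldTheory.Balaban1983to89.T4AxialGaugeSmallField (castSite)
open Literature.MathematicalPhysics.QuantumFieldTheory.Balaban1983to89.B7Prop1Explicit (e)
open Summit.QuantumFields.YangMills.Theorems.UnitScaleGibbsTemporalGaugePrimitiveTorus (sum_pbond_eq_sum_box)
open Summit.QuantumFields.YangMills.Theorems.UnitScaleGibbsTestFieldSU2DressingPush (push_eq_zero_of_not_le mem_piFinset_Icc_iff)
open Summit.QuantumFields.YangMills.Theorems.UnitScaleGibbsTruncatedPotentialCollarMass (collarMass_le_far')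

namespace Summit.QuantumFields.YangMills.Theorems.GrossTransferStubLinTestCollarFloorRow

/-! ## §1 A non-negative push is read out from above on the box -/

/-- For a push `A` of a NON-NEGATIVE `ℤ^d` bond function `f` onto the torus box `[lo, hi]`: `Σ_b A b ≤ Σ_{x ∈ [lo,hi]} Σ_μ f x μ` (at `(x, μ)` with `x + e_μ ≤ hi` the push reads `f`,
elsewhere `0 ≤ f`). [folklore] -/
theorem sum_push_le_sum_box {P : Params} {j : ℕ} {lo hi : Fin P.d → ℤ} (hN : ∀ κ, hi κ - lo κ < P.sitesPerDir j)
    (f : Zd P.d → Fin P.d → ℝ) (hf : ∀ x μ, 0 ≤ f x μ) (A : PBond P j → ℝ)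
    (hA : ∀ (x : Fin P.d → ℤ) (μ : Fin P.d), lo ≤ x → x + e μ ≤ hi → A ⟨castSite x, μ⟩ = f x μ)
    (hA0 : ∀ b : PBond P j, (¬ ∃ y : Fin P.d → ℤ, lo ≤ y ∧ y + e b.dir ≤ hi ∧ b.src = castSite y) → A b = 0) :
    ∑ b : PBond P j, A b ≤ ∑ x ∈ Fintype.piFinset (fun i => Finset.Icc (lo i) (hi i)), ∑ μ : Fin P.d, f x μ := by
  classical
  rw [sum_pbond_eq_sum_box hN A (fun b hb => by
      by_cases h : ∃ y : Fin P.d → ℤ, lo ≤ y ∧ y + e b.dir ≤ hi ∧ b.src = castSite y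
      · exact h
      · exact absurd (hA0 b h) hb)]
  refine Finset.sum_le_sum fun x hx => Finset.sum_le_sum fun μ _ => ?_
  obtain ⟨hxlo, hxhi⟩ := (mem_piFinset_Icc_iff x).1 hx
  by_cases hin : x + e μ ≤ hi
  · rw [hA x μ hxlo hin]
  · rw [push_eq_zero_of_not_le hN A hA0 hxlo hxhi hin]; exact hf x μ

/-! ## §2 The two real-arithmetic steps -/

/-- `(6R+5)³·3·Pt ≤ 370440·(C₁+C₂)·M∕R` for `Pt = (2∕R)(45∕2)(C₂∕N³)M + (4∕R²)(45∕2)(C₁∕N²)M`, `R ≤ 2N`, `5 ≤ R`. [folklore] -/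
theorem collar_arith {R N M C₁ C₂ : ℝ} (hR : 5 ≤ R) (hN : 0 < N) (hRN : R ≤ 2 * N) (hM : 0 ≤ M) (hC₁ : 0 ≤ C₁) (hC₂ : 0 ≤ C₂) :
    (2 * (3 * R + 2) + 1) ^ 3 * (135 / 2 * (2 / R * (C₂ / N ^ 3) + 4 / R ^ 2 * (C₁ / N ^ 2)) * M)
      ≤ 370440 * (C₁ + C₂) * M / R := by
  have hR0 : 0 < R := by linarith
  have hR2 : 0 < R / 2 := by positivity
  have hN3 : C₂ / N ^ 3 ≤ C₂ / (R / 2) ^ 3 := div_le_div_of_nonneg_left hC₂ (pow_pos hR2 3) (pow_le_pow_left₀ hR2.le (by linarith) 3)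
  have hN2 : C₁ / N ^ 2 ≤ C₁ / (R / 2) ^ 2 := div_le_div_of_nonneg_left hC₁ (pow_pos hR2 2) (pow_le_pow_left₀ hR2.le (by linarith) 2)
  have hcube : (2 * (3 * R + 2) + 1) ^ 3 ≤ (7 * R) ^ 3 := pow_le_pow_left₀ (by linarith) (by linarith) 3
  have h2R : 0 ≤ 2 / R := by positivity
  have h4R : 0 ≤ 4 / R ^ 2 := by positivity
  have hin : 2 / R * (C₂ / N ^ 3) + 4 / R ^ 2 * (C₁ / N ^ 2) ≤ 2 / R * (C₂ / (R / 2) ^ 3) + 4 / R ^ 2 * (C₁ / (R / 2) ^ 2) :=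
    add_le_add (mul_le_mul_of_nonneg_left hN3 h2R) (mul_le_mul_of_nonneg_left hN2 h4R)
  have hPt : 135 / 2 * (2 / R * (C₂ / N ^ 3) + 4 / R ^ 2 * (C₁ / N ^ 2)) * M ≤ 135 / 2 * (2 / R * (C₂ / (R / 2) ^ 3) + 4 / R ^ 2 * (C₁ / (R / 2) ^ 2)) * M :=
    mul_le_mul_of_nonneg_right (mul_le_mul_of_nonneg_left hin (by norm_num)) hM
  calc (2 * (3 * R + 2) + 1) ^ 3 * (135 / 2 * (2 / R * (C₂ / N ^ 3) + 4 / R ^ 2 * (C₁ / N ^ 2)) * M)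
      ≤ (7 * R) ^ 3 * (135 / 2 * (2 / R * (C₂ / (R / 2) ^ 3) + 4 / R ^ 2 * (C₁ / (R / 2) ^ 2)) * M) :=
        mul_le_mul hcube hPt (by positivity) (by positivity)
    _ = 370440 * (C₁ + C₂) * M / R := by
        field_simp
        ring

/-- `(6R+6)·192·(370440(C₁+C₂)M∕R)² ≤ 9072·370440²·(C₁+C₂)²·L^j` for `M ≤ 9(L²)^j`, `12·L^{3j} ≤ R`, `6 ≤ R`, `1 ≤ L`. [folklore] -/
theorem row_arith {R M C₁ C₂ L : ℝ} {j : ℕ} (hR : 6 ≤ R) (hM : 0 ≤ M) (hM9 : M ≤ 9 * (L ^ 2) ^ j) (hL : 1 ≤ L) (hRL : 12 * L ^ (3 * j) ≤ R) :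
    (6 * R + 6) * (192 * (370440 * (C₁ + C₂) * M / R) ^ 2) ≤ 9072 * 370440 ^ 2 * (C₁ + C₂) ^ 2 * L ^ j := by
  have hR0 : 0 < R := by linarith
  have hL0 : 0 < L := by linarith
  have hLj : 0 < L ^ j := pow_pos hL0 j
  have hL3j : 0 < L ^ (3 * j) := pow_pos hL0 _
  -- `M² ≤ 81·L^{4j}`
  have hM2 : M ^ 2 ≤ 81 * (L ^ j * L ^ (3 * j)) := by
    have h := pow_le_pow_left₀ hM hM9 2
    have e : (9 * (L ^ 2) ^ j) ^ 2 = 81 * (L ^ j * L ^ (3 * j)) := by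
      rw [mul_pow, ← pow_mul, ← pow_mul, ← pow_add]; norm_num; ring_nf
    linarith [h, e.le, e.ge]
  -- `(6R+6)/R² ≤ 7/R` and `1/R ≤ 1/(12 L^{3j})`
  have h7 : 6 * R + 6 ≤ 7 * R := by linarith
  have hinv : (C₁ + C₂) ^ 2 * M ^ 2 * (6 * R + 6) / R ^ 2 ≤ (C₁ + C₂) ^ 2 * (81 * (L ^ j * L ^ (3 * j))) * 7 / R := by
    rw [div_le_div_iff₀ (by positivity) hR0]
    have hc : 0 ≤ (C₁ + C₂) ^ 2 := sq_nonneg _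
    nlinarith [mul_le_mul (mul_le_mul_of_nonneg_left hM2 hc) h7 (by positivity) (by positivity), sq_nonneg R]
  have hstep : (C₁ + C₂) ^ 2 * (81 * (L ^ j * L ^ (3 * j))) * 7 / R ≤ (C₁ + C₂) ^ 2 * (81 * (L ^ j * L ^ (3 * j))) * 7 / (12 * L ^ (3 * j)) :=
    div_le_div_of_nonneg_left (by positivity) (by positivity) hRL
  calc (6 * R + 6) * (192 * (370440 * (C₁ + C₂) * M / R) ^ 2)
      = 192 * 370440 ^ 2 * ((C₁ + C₂) ^ 2 * M ^ 2 * (6 * R + 6) / R ^ 2) := by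
        field_simp
    _ ≤ 192 * 370440 ^ 2 * ((C₁ + C₂) ^ 2 * (81 * (L ^ j * L ^ (3 * j))) * 7 / (12 * L ^ (3 * j))) :=
        mul_le_mul_of_nonneg_left (hinv.trans hstep) (by positivity)
    _ = 9072 * 370440 ^ 2 * (C₁ + C₂) ^ 2 * L ^ j := by
        field_simp
        ring

/-! ## §3 ★★★ The row -/

/-- ★★★ **THE BOND WEIGHTS' TOTAL MASS** (skeleton letters; `M` any bound of the cone read-out's `ℓ¹` mass `M₀`): with the collar far-field row on BOTH `δσ`-sums,
`Σ_b ω b ≤ 192·(370440·(C₁+C₂)·M∕R)²`.  Size rows displayed: `2 ≤ N`, `N + R₀ + 4 ≤ R`, `R ≤ 2N`, `5 ≤ R`. [cite: Balaban1984PropagatorsII, (1.9) p.226] -/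
theorem sum_omega_le (F : T3Family) (K : ℕ) {lo hi : Fin (F.P K).d → ℤ} (hN : ∀ κ, hi κ - lo κ < (F.P K).sitesPerDir 0)
    {C₁ C₂ : ℝ} (hC₁ : 0 ≤ C₁) (hC₂ : 0 ≤ C₂)
    (hK1 : ∀ (e : Fin 3) (w : Zd 3) (n : ℕ), 1 ≤ n → w ∉ box (0 : Zd 3) ((n : ℤ) - 1) →
      |latticeGreen (w + unitVec e) - latticeGreen w| ≤ C₁ / (n : ℝ) ^ 2)
    (hK2 : ∀ (e : Fin 3) (w : Zd 3) (n : ℕ), 2 ≤ n → w ∉ box (0 : Zd 3) ((n : ℤ) - 1) → ∀ i : Fin 3,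
      |(latticeGreen (w + unitVec i + unitVec e) - latticeGreen (w + unitVec i)) - (latticeGreen (w + unitVec e) - latticeGreen w)| ≤ C₂ / (n : ℝ) ^ 3)
    (wt βt : Zd (F.P K).d → Fin (F.P K).d → Fin (F.P K).d → ℝ) (at' : Zd (F.P K).d → Fin (F.P K).d → ℝ)
    (γt : Zd (F.P K).d → Fin (F.P K).d → Fin (F.P K).d → Fin (F.P K).d → ℝ)
    (z₀ : Zd (F.P K).d) (R₀ : ℕ)
    (hβt : ∀ x μ ν, βt x μ ν = ∑ y ∈ box z₀ (R₀ : ℤ), latticeGreen (x - y) / 2 * wt y μ ν)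
    (hat : ∀ x ν, at' x ν = ∑ μ, (βt (x - unitVec μ) μ ν - βt x μ ν))
    (hγt : ∀ x κ μ ν, γt x κ μ ν =
      (βt (x + unitVec κ) μ ν - βt x μ ν) - (βt (x + unitVec μ) κ ν - βt x κ ν) + (βt (x + unitVec ν) κ μ - βt x κ μ))
    {M : ℝ} (hM0 : 0 ≤ M) (hM : ∑ μ, ∑ ν', ∑ y ∈ box z₀ (R₀ : ℤ), |wt y μ ν'| ≤ M)
    (χ : Zd (F.P K).d → ℝ) (R : ℕ) (hχ1 : ∀ x ∈ box z₀ (R : ℤ), χ x = 1) (hχ0 : ∀ x, x ∉ box z₀ (3 * (R : ℤ)) → χ x = 0)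
    (hχp : ∀ x (μ : Fin (F.P K).d), |χ (x + unitVec μ) - χ x| ≤ 2 / (R : ℝ))
    (hχm : ∀ x (μ : Fin (F.P K).d), |χ (x - unitVec μ) - χ x| ≤ 2 / (R : ℝ))
    (hχ2 : ∀ x (κ μ : Fin (F.P K).d), |χ (x + unitVec κ + unitVec μ) - χ (x + unitVec κ) - χ (x + unitVec μ) + χ x| ≤ 4 / (R : ℝ) ^ 2)
    (E1 C2 σ : Zd (F.P K).d → Fin (F.P K).d → Fin (F.P K).d → ℝ) (δσ : Zd (F.P K).d → Fin (F.P K).d → ℝ)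
    (hE1 : ∀ x μ ν, E1 x μ ν = (χ (x + unitVec μ) - χ x) * at' (x + unitVec μ) ν - (χ (x + unitVec ν) - χ x) * at' (x + unitVec ν) μ)
    (hC2 : ∀ x μ ν, C2 x μ ν = ∑ κ, (χ x - χ (x - unitVec κ)) * γt (x - unitVec κ) κ μ ν)
    (hσ : ∀ x μ ν, σ x μ ν = E1 x μ ν - C2 x μ ν)
    (hδσ : ∀ y ν, δσ y ν = ∑ μ, (σ (y - unitVec μ) μ ν - σ y μ ν))
    (W : ℝ) (hW : W = ∑ y ∈ box z₀ (3 * (R : ℤ) + 1), ∑ ν, |δσ y ν|)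
    (ω : PBond (F.P K) 0 → ℝ)
    (hω : ∀ (x : Fin (F.P K).d → ℤ) (μ : Fin (F.P K).d), lo ≤ x → x + e μ ≤ hi → ω ⟨castSite x, μ⟩ = 192 * W * |δσ x μ|)
    (hωoff : ∀ b : PBond (F.P K) 0, (¬ ∃ y : Fin (F.P K).d → ℤ, lo ≤ y ∧ y + e b.dir ≤ hi ∧ b.src = castSite y) → ω b = 0)
    (N : ℕ) (hN2 : 2 ≤ N) (hNR : (N : ℤ) + R₀ + 4 ≤ R) (hRN : R ≤ 2 * N) (hR5 : 5 ≤ R) :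
    ∑ b : PBond (F.P K) 0, ω b ≤ 192 * (370440 * (C₁ + C₂) * M / R) ^ 2 := by
  classical
  -- sizes
  have hR0 : (0 : ℝ) < R := by exact_mod_cast (show 0 < R by omega)
  have hRr : (5 : ℝ) ≤ R := by exact_mod_cast hR5
  have hNr : (0 : ℝ) < N := by exact_mod_cast (show 0 < N by omega)
  have hRNr : (R : ℝ) ≤ 2 * N := by exact_mod_cast hRN
  have hρ0 : (0 : ℝ) ≤ 2 / (R : ℝ) := by positivity
  have hρ₂0 : (0 : ℝ) ≤ 4 / (R : ℝ) ^ 2 := by positivity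
  have hM00 : 0 ≤ ∑ μ', ∑ ν', ∑ y' ∈ box z₀ (R₀ : ℤ), |wt y' μ' ν'| :=
    Finset.sum_nonneg fun _ _ => Finset.sum_nonneg fun _ _ => Finset.sum_nonneg fun _ _ => abs_nonneg _
  -- the split `|δσ| ≤ |δ₂E1| + |δ₂C2|`
  have hsplit : ∀ y ν, |δσ y ν| ≤ |∑ μ, (E1 (y - unitVec μ) μ ν - E1 y μ ν)| + |∑ μ, (C2 (y - unitVec μ) μ ν - C2 y μ ν)| := by
    intro y ν
    have e : δσ y ν = ∑ μ, (E1 (y - unitVec μ) μ ν - E1 y μ ν) - ∑ μ, (C2 (y - unitVec μ) μ ν - C2 y μ ν) := by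
      rw [hδσ, ← Finset.sum_sub_distrib]
      refine Finset.sum_congr rfl fun μ _ => ?_
      rw [hσ, hσ]; ring
    rw [e]; exact abs_sub _ _
  -- the `ℤ³` collar row of w3-19936 g18 on any finite set (`S := 3R`, `ℓ := R₀`, `p := z₀`, `ρ := 2∕R`, `ρ₂ := 4∕R²`)
  have hχ0' : ∀ x, x ∉ box z₀ ((3 * R : ℕ) : ℤ) → χ x = 0 := fun x hx => hχ0 x (by exact_mod_cast hx)
  set Pt : ℝ := 135 / 2 * (2 / (R : ℝ) * (C₂ / (N : ℝ) ^ 3) + 4 / (R : ℝ) ^ 2 * (C₁ / (N : ℝ) ^ 2)) * ∑ μ', ∑ ν', ∑ y' ∈ box z₀ (R₀ : ℤ), |wt y' μ' ν'|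
    with hPt
  have hrow : ∀ B : Finset (Zd (F.P K).d), ∑ y ∈ B, ∑ ν, |δσ y ν| ≤ ((box z₀ (((3 * R : ℕ) : ℤ) + 2)).card : ℝ) * Pt := fun B =>
    (Finset.sum_le_sum fun y _ => Finset.sum_le_sum fun ν _ => hsplit y ν).trans
      (collarMass_le_far' hK1 hK2 wt βt at' γt z₀ R₀ hβt hat hγt χ E1 C2 hE1 hC2 R (3 * R) hχ1 hχ0' hχp hχm hχ2 hC₁ hC₂ N hN2 hNR hρ0 hρ₂0 B)
  have hPtM : Pt ≤ 135 / 2 * (2 / (R : ℝ) * (C₂ / (N : ℝ) ^ 3) + 4 / (R : ℝ) ^ 2 * (C₁ / (N : ℝ) ^ 2)) * M := by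
    rw [hPt]
    exact mul_le_mul_of_nonneg_left hM (by positivity)
  have hcard : ((box z₀ (((3 * R : ℕ) : ℤ) + 2)).card : ℝ) = (2 * (3 * (R : ℝ) + 2) + 1) ^ 3 := by
    rw [card_box z₀ (by positivity)]
    have hd : (F.P K).d = 3 := rfl
    rw [hd]; push_cast; ring
  have hBd : ((box z₀ (((3 * R : ℕ) : ℤ) + 2)).card : ℝ) * Pt ≤ 370440 * (C₁ + C₂) * M / R := by
    rw [hcard]
    refine le_trans (mul_le_mul_of_nonneg_left hPtM (by positivity)) ?_
    exact collar_arith hRr hNr hRNr hM0 hC₁ hC₂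
  have hBd0 : 0 ≤ 370440 * (C₁ + C₂) * M / R := by positivity
  -- `W ≤ Bd` and `Σ_{box}|δσ| ≤ Bd`
  have hWle : W ≤ 370440 * (C₁ + C₂) * M / R := by rw [hW]; exact (hrow _).trans hBd
  have hW0 : 0 ≤ W := by rw [hW]; exact Finset.sum_nonneg fun _ _ => Finset.sum_nonneg fun _ _ => abs_nonneg _
  have hbox := (hrow (Fintype.piFinset fun i => Finset.Icc (lo i) (hi i))).trans hBd
  -- the push read-out
  have hpush := sum_push_le_sum_box hN (fun x μ => 192 * W * |δσ x μ|) (fun x μ => by positivity) ω hω hωoff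
  calc ∑ b : PBond (F.P K) 0, ω b
      ≤ ∑ x ∈ Fintype.piFinset (fun i => Finset.Icc (lo i) (hi i)), ∑ μ : Fin (F.P K).d, 192 * W * |δσ x μ| := hpush
    _ = 192 * W * ∑ x ∈ Fintype.piFinset (fun i => Finset.Icc (lo i) (hi i)), ∑ μ : Fin (F.P K).d, |δσ x μ| := by
        rw [Finset.mul_sum]; refine Finset.sum_congr rfl fun x _ => ?_; rw [Finset.mul_sum]
    _ ≤ 192 * (370440 * (C₁ + C₂) * M / R) * (370440 * (C₁ + C₂) * M / R) := by
        have h192 : 0 ≤ 192 * W := by positivity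
        exact mul_le_mul (mul_le_mul_of_nonneg_left hWle (by norm_num)) hbox
          (Finset.sum_nonneg fun _ _ => Finset.sum_nonneg fun _ _ => abs_nonneg _) (by positivity)
    _ = 192 * (370440 * (C₁ + C₂) * M / R) ^ 2 := by ring

/-- ★★★ **ROW (R7) «COLLAR FLOOR»** (the KNIT-E2 bullet's goal shape): with `n = 6R + 6`, `M₀ ≤ 9(L²)^j`, `12·L^{3j} ≤ R` and the size rows of `sum_omega_le`:
`(n:ℝ)·Σ_b ω b ≤ 9072·370440²·(C₁+C₂)²·(F.L)^j`. [cite: GrossCMP1983, Thm 2.2; Balaban1984PropagatorsII, (1.9) p.226] -/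
theorem collarFloor_row_le (F : T3Family) (K : ℕ) {lo hi : Fin (F.P K).d → ℤ} (hN : ∀ κ, hi κ - lo κ < (F.P K).sitesPerDir 0)
    {C₁ C₂ : ℝ} (hC₁ : 0 ≤ C₁) (hC₂ : 0 ≤ C₂)
    (hK1 : ∀ (e : Fin 3) (w : Zd 3) (n : ℕ), 1 ≤ n → w ∉ box (0 : Zd 3) ((n : ℤ) - 1) →
      |latticeGreen (w + unitVec e) - latticeGreen w| ≤ C₁ / (n : ℝ) ^ 2)
    (hK2 : ∀ (e : Fin 3) (w : Zd 3) (n : ℕ), 2 ≤ n → w ∉ box (0 : Zd 3) ((n : ℤ) - 1) → ∀ i : Fin 3,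
      |(latticeGreen (w + unitVec i + unitVec e) - latticeGreen (w + unitVec i)) - (latticeGreen (w + unitVec e) - latticeGreen w)| ≤ C₂ / (n : ℝ) ^ 3)
    {j : ℕ}
    (wt βt : Zd (F.P K).d → Fin (F.P K).d → Fin (F.P K).d → ℝ) (at' : Zd (F.P K).d → Fin (F.P K).d → ℝ)
    (γt : Zd (F.P K).d → Fin (F.P K).d → Fin (F.P K).d → Fin (F.P K).d → ℝ)
    (z₀ : Zd (F.P K).d) (R₀ : ℕ)
    (hβt : ∀ x μ ν, βt x μ ν = ∑ y ∈ box z₀ (R₀ : ℤ), latticeGreen (x - y) / 2 * wt y μ ν)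
    (hat : ∀ x ν, at' x ν = ∑ μ, (βt (x - unitVec μ) μ ν - βt x μ ν))
    (hγt : ∀ x κ μ ν, γt x κ μ ν =
      (βt (x + unitVec κ) μ ν - βt x μ ν) - (βt (x + unitVec μ) κ ν - βt x κ ν) + (βt (x + unitVec ν) κ μ - βt x κ μ))
    (hM9 : ∑ μ, ∑ ν', ∑ y ∈ box z₀ (R₀ : ℤ), |wt y μ ν'| ≤ 9 * (((F.L : ℝ)) ^ 2) ^ j)
    (χ : Zd (F.P K).d → ℝ) (R : ℕ) (hχ1 : ∀ x ∈ box z₀ (R : ℤ), χ x = 1) (hχ0 : ∀ x, x ∉ box z₀ (3 * (R : ℤ)) → χ x = 0)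
    (hχp : ∀ x (μ : Fin (F.P K).d), |χ (x + unitVec μ) - χ x| ≤ 2 / (R : ℝ))
    (hχm : ∀ x (μ : Fin (F.P K).d), |χ (x - unitVec μ) - χ x| ≤ 2 / (R : ℝ))
    (hχ2 : ∀ x (κ μ : Fin (F.P K).d), |χ (x + unitVec κ + unitVec μ) - χ (x + unitVec κ) - χ (x + unitVec μ) + χ x| ≤ 4 / (R : ℝ) ^ 2)
    (E1 C2 σ : Zd (F.P K).d → Fin (F.P K).d → Fin (F.P K).d → ℝ) (δσ : Zd (F.P K).d → Fin (F.P K).d → ℝ)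
    (hE1 : ∀ x μ ν, E1 x μ ν = (χ (x + unitVec μ) - χ x) * at' (x + unitVec μ) ν - (χ (x + unitVec ν) - χ x) * at' (x + unitVec ν) μ)
    (hC2 : ∀ x μ ν, C2 x μ ν = ∑ κ, (χ x - χ (x - unitVec κ)) * γt (x - unitVec κ) κ μ ν)
    (hσ : ∀ x μ ν, σ x μ ν = E1 x μ ν - C2 x μ ν)
    (hδσ : ∀ y ν, δσ y ν = ∑ μ, (σ (y - unitVec μ) μ ν - σ y μ ν))
    (W : ℝ) (hW : W = ∑ y ∈ box z₀ (3 * (R : ℤ) + 1), ∑ ν, |δσ y ν|)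
    (ω : PBond (F.P K) 0 → ℝ)
    (hω : ∀ (x : Fin (F.P K).d → ℤ) (μ : Fin (F.P K).d), lo ≤ x → x + e μ ≤ hi → ω ⟨castSite x, μ⟩ = 192 * W * |δσ x μ|)
    (hωoff : ∀ b : PBond (F.P K) 0, (¬ ∃ y : Fin (F.P K).d → ℤ, lo ≤ y ∧ y + e b.dir ≤ hi ∧ b.src = castSite y) → ω b = 0)
    (n : ℕ) (hn : n = 6 * R + 6)
    (N : ℕ) (hN2 : 2 ≤ N) (hNR : (N : ℤ) + R₀ + 4 ≤ R) (hRN : R ≤ 2 * N) (hRL : 12 * F.L ^ (3 * j) ≤ R) :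
    (n : ℝ) * ∑ b : PBond (F.P K) 0, ω b ≤ 9072 * 370440 ^ 2 * (C₁ + C₂) ^ 2 * (F.L : ℝ) ^ j := by
  have hL2 : 2 ≤ F.L := F.hL.2
  have hL1r : (1 : ℝ) ≤ (F.L : ℝ) := by exact_mod_cast le_trans (by norm_num) hL2
  have hR12 : 12 ≤ R := by
    have h1 : 1 ≤ F.L ^ (3 * j) := Nat.one_le_pow _ _ (le_trans (by norm_num) hL2)
    have := Nat.mul_le_mul_left 12 h1
    omega
  have hM0 : (0 : ℝ) ≤ 9 * (((F.L : ℝ)) ^ 2) ^ j := by positivity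
  have hω_le := sum_omega_le F K hN hC₁ hC₂ hK1 hK2 wt βt at' γt z₀ R₀ hβt hat hγt hM0 hM9 χ R hχ1 hχ0 hχp hχm hχ2 E1 C2 σ δσ hE1 hC2 hσ hδσ
    W hW ω hω hωoff N hN2 hNR hRN (by omega)
  have hn0 : (0 : ℝ) ≤ n := Nat.cast_nonneg n
  have hRr : (6 : ℝ) ≤ R := by exact_mod_cast (le_trans (by norm_num) hR12)
  have hRLr : 12 * (F.L : ℝ) ^ (3 * j) ≤ R := by exact_mod_cast hRL
  calc (n : ℝ) * ∑ b : PBond (F.P K) 0, ω b ≤ (n : ℝ) * (192 * (370440 * (C₁ + C₂) * (9 * (((F.L : ℝ)) ^ 2) ^ j) / R) ^ 2) :=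
        mul_le_mul_of_nonneg_left hω_le hn0
    _ = (6 * (R : ℝ) + 6) * (192 * (370440 * (C₁ + C₂) * (9 * (((F.L : ℝ)) ^ 2) ^ j) / R) ^ 2) := by rw [hn]; push_cast; ring
    _ ≤ 9072 * 370440 ^ 2 * (C₁ + C₂) ^ 2 * (F.L : ℝ) ^ j := row_arith hRr hM0 le_rfl hL1r hRLr

/-! ## §4 (v1.1, APPEND-ONLY — §1–§3 byte-identical) The collar mass over any finite set ∕ over `Q_{3R+2}(z₀)` (pen's corrected letter) -/

/-- ★★★ **THE BOND WEIGHTS' TOTAL MASS, COLLAR MASS OVER ANY FINITE SET** (v1.1 twin of `sum_omega_le`; pen ★w2-19936 g15 2026-08-29T23:44:53Z one-letter correction «`W := Σ_{y ∈ box z₀ (3R+2)} Σ_ν |δσ y ν|`, not `3R+1`»):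
the collar far-field row ✓`collarMass_le_far'` bounds `Σ_{y ∈ B} Σ_ν |δσ y ν|` for EVERY finite `B` by the same `#Q_{3R+2}(z₀)·Pt`, so with `W = Σ_{y ∈ B} Σ_ν |δσ y ν|` for any `B`
(in particular `B = Q_{3R+2}(z₀)`): `Σ_b ω b ≤ 192·(370440·(C₁+C₂)·M∕R)²`.  Size rows as in `sum_omega_le`. [cite: Balaban1984PropagatorsII, (1.9) p.226] -/
theorem sum_omega_le_of_eq_sum (F : T3Family) (K : ℕ) {lo hi : Fin (F.P K).d → ℤ} (hN : ∀ κ, hi κ - lo κ < (F.P K).sitesPerDir 0)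
    {C₁ C₂ : ℝ} (hC₁ : 0 ≤ C₁) (hC₂ : 0 ≤ C₂)
    (hK1 : ∀ (e : Fin 3) (w : Zd 3) (n : ℕ), 1 ≤ n → w ∉ box (0 : Zd 3) ((n : ℤ) - 1) →
      |latticeGreen (w + unitVec e) - latticeGreen w| ≤ C₁ / (n : ℝ) ^ 2)
    (hK2 : ∀ (e : Fin 3) (w : Zd 3) (n : ℕ), 2 ≤ n → w ∉ box (0 : Zd 3) ((n : ℤ) - 1) → ∀ i : Fin 3,
      |(latticeGreen (w + unitVec i + unitVec e) - latticeGreen (w + unitVec i)) - (latticeGreen (w + unitVec e) - latticeGreen w)| ≤ C₂ / (n : ℝ) ^ 3)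
    (wt βt : Zd (F.P K).d → Fin (F.P K).d → Fin (F.P K).d → ℝ) (at' : Zd (F.P K).d → Fin (F.P K).d → ℝ)
    (γt : Zd (F.P K).d → Fin (F.P K).d → Fin (F.P K).d → Fin (F.P K).d → ℝ)
    (z₀ : Zd (F.P K).d) (R₀ : ℕ)
    (hβt : ∀ x μ ν, βt x μ ν = ∑ y ∈ box z₀ (R₀ : ℤ), latticeGreen (x - y) / 2 * wt y μ ν)
    (hat : ∀ x ν, at' x ν = ∑ μ, (βt (x - unitVec μ) μ ν - βt x μ ν))
    (hγt : ∀ x κ μ ν, γt x κ μ ν =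
      (βt (x + unitVec κ) μ ν - βt x μ ν) - (βt (x + unitVec μ) κ ν - βt x κ ν) + (βt (x + unitVec ν) κ μ - βt x κ μ))
    {M : ℝ} (hM0 : 0 ≤ M) (hM : ∑ μ, ∑ ν', ∑ y ∈ box z₀ (R₀ : ℤ), |wt y μ ν'| ≤ M)
    (χ : Zd (F.P K).d → ℝ) (R : ℕ) (hχ1 : ∀ x ∈ box z₀ (R : ℤ), χ x = 1) (hχ0 : ∀ x, x ∉ box z₀ (3 * (R : ℤ)) → χ x = 0)
    (hχp : ∀ x (μ : Fin (F.P K).d), |χ (x + unitVec μ) - χ x| ≤ 2 / (R : ℝ))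
    (hχm : ∀ x (μ : Fin (F.P K).d), |χ (x - unitVec μ) - χ x| ≤ 2 / (R : ℝ))
    (hχ2 : ∀ x (κ μ : Fin (F.P K).d), |χ (x + unitVec κ + unitVec μ) - χ (x + unitVec κ) - χ (x + unitVec μ) + χ x| ≤ 4 / (R : ℝ) ^ 2)
    (E1 C2 σ : Zd (F.P K).d → Fin (F.P K).d → Fin (F.P K).d → ℝ) (δσ : Zd (F.P K).d → Fin (F.P K).d → ℝ)
    (hE1 : ∀ x μ ν, E1 x μ ν = (χ (x + unitVec μ) - χ x) * at' (x + unitVec μ) ν - (χ (x + unitVec ν) - χ x) * at' (x + unitVec ν) μ)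
    (hC2 : ∀ x μ ν, C2 x μ ν = ∑ κ, (χ x - χ (x - unitVec κ)) * γt (x - unitVec κ) κ μ ν)
    (hσ : ∀ x μ ν, σ x μ ν = E1 x μ ν - C2 x μ ν)
    (hδσ : ∀ y ν, δσ y ν = ∑ μ, (σ (y - unitVec μ) μ ν - σ y μ ν))
    (B : Finset (Zd (F.P K).d)) (W : ℝ) (hW : W = ∑ y ∈ B, ∑ ν, |δσ y ν|)
    (ω : PBond (F.P K) 0 → ℝ)
    (hω : ∀ (x : Fin (F.P K).d → ℤ) (μ : Fin (F.P K).d), lo ≤ x → x + e μ ≤ hi → ω ⟨castSite x, μ⟩ = 192 * W * |δσ x μ|)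
    (hωoff : ∀ b : PBond (F.P K) 0, (¬ ∃ y : Fin (F.P K).d → ℤ, lo ≤ y ∧ y + e b.dir ≤ hi ∧ b.src = castSite y) → ω b = 0)
    (N : ℕ) (hN2 : 2 ≤ N) (hNR : (N : ℤ) + R₀ + 4 ≤ R) (hRN : R ≤ 2 * N) (hR5 : 5 ≤ R) :
    ∑ b : PBond (F.P K) 0, ω b ≤ 192 * (370440 * (C₁ + C₂) * M / R) ^ 2 := by
  classical
  -- sizes
  have hR0 : (0 : ℝ) < R := by exact_mod_cast (show 0 < R by omega)
  have hRr : (5 : ℝ) ≤ R := by exact_mod_cast hR5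
  have hNr : (0 : ℝ) < N := by exact_mod_cast (show 0 < N by omega)
  have hRNr : (R : ℝ) ≤ 2 * N := by exact_mod_cast hRN
  have hρ0 : (0 : ℝ) ≤ 2 / (R : ℝ) := by positivity
  have hρ₂0 : (0 : ℝ) ≤ 4 / (R : ℝ) ^ 2 := by positivity
  have hM00 : 0 ≤ ∑ μ', ∑ ν', ∑ y' ∈ box z₀ (R₀ : ℤ), |wt y' μ' ν'| :=
    Finset.sum_nonneg fun _ _ => Finset.sum_nonneg fun _ _ => Finset.sum_nonneg fun _ _ => abs_nonneg _
  -- the split `|δσ| ≤ |δ₂E1| + |δ₂C2|`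
  have hsplit : ∀ y ν, |δσ y ν| ≤ |∑ μ, (E1 (y - unitVec μ) μ ν - E1 y μ ν)| + |∑ μ, (C2 (y - unitVec μ) μ ν - C2 y μ ν)| := by
    intro y ν
    have e : δσ y ν = ∑ μ, (E1 (y - unitVec μ) μ ν - E1 y μ ν) - ∑ μ, (C2 (y - unitVec μ) μ ν - C2 y μ ν) := by
      rw [hδσ, ← Finset.sum_sub_distrib]
      refine Finset.sum_congr rfl fun μ _ => ?_
      rw [hσ, hσ]; ring
    rw [e]; exact abs_sub _ _
  -- the `ℤ³` collar row of w3-19936 g18 on any finite set (`S := 3R`, `ℓ := R₀`, `p := z₀`, `ρ := 2∕R`, `ρ₂ := 4∕R²`)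
  have hχ0' : ∀ x, x ∉ box z₀ ((3 * R : ℕ) : ℤ) → χ x = 0 := fun x hx => hχ0 x (by exact_mod_cast hx)
  set Pt : ℝ := 135 / 2 * (2 / (R : ℝ) * (C₂ / (N : ℝ) ^ 3) + 4 / (R : ℝ) ^ 2 * (C₁ / (N : ℝ) ^ 2)) * ∑ μ', ∑ ν', ∑ y' ∈ box z₀ (R₀ : ℤ), |wt y' μ' ν'|
    with hPt
  have hrow : ∀ B : Finset (Zd (F.P K).d), ∑ y ∈ B, ∑ ν, |δσ y ν| ≤ ((box z₀ (((3 * R : ℕ) : ℤ) + 2)).card : ℝ) * Pt := fun B =>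
    (Finset.sum_le_sum fun y _ => Finset.sum_le_sum fun ν _ => hsplit y ν).trans
      (collarMass_le_far' hK1 hK2 wt βt at' γt z₀ R₀ hβt hat hγt χ E1 C2 hE1 hC2 R (3 * R) hχ1 hχ0' hχp hχm hχ2 hC₁ hC₂ N hN2 hNR hρ0 hρ₂0 B)
  have hPtM : Pt ≤ 135 / 2 * (2 / (R : ℝ) * (C₂ / (N : ℝ) ^ 3) + 4 / (R : ℝ) ^ 2 * (C₁ / (N : ℝ) ^ 2)) * M := by
    rw [hPt]
    exact mul_le_mul_of_nonneg_left hM (by positivity)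
  have hcard : ((box z₀ (((3 * R : ℕ) : ℤ) + 2)).card : ℝ) = (2 * (3 * (R : ℝ) + 2) + 1) ^ 3 := by
    rw [card_box z₀ (by positivity)]
    have hd : (F.P K).d = 3 := rfl
    rw [hd]; push_cast; ring
  have hBd : ((box z₀ (((3 * R : ℕ) : ℤ) + 2)).card : ℝ) * Pt ≤ 370440 * (C₁ + C₂) * M / R := by
    rw [hcard]
    refine le_trans (mul_le_mul_of_nonneg_left hPtM (by positivity)) ?_
    exact collar_arith hRr hNr hRNr hM0 hC₁ hC₂
  have hBd0 : 0 ≤ 370440 * (C₁ + C₂) * M / R := by positivity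
  -- `W ≤ Bd` and `Σ_{box}|δσ| ≤ Bd`
  have hWle : W ≤ 370440 * (C₁ + C₂) * M / R := by rw [hW]; exact (hrow _).trans hBd
  have hW0 : 0 ≤ W := by rw [hW]; exact Finset.sum_nonneg fun _ _ => Finset.sum_nonneg fun _ _ => abs_nonneg _
  have hbox := (hrow (Fintype.piFinset fun i => Finset.Icc (lo i) (hi i))).trans hBd
  -- the push read-out
  have hpush := sum_push_le_sum_box hN (fun x μ => 192 * W * |δσ x μ|) (fun x μ => by positivity) ω hω hωoff
  calc ∑ b : PBond (F.P K) 0, ω b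
      ≤ ∑ x ∈ Fintype.piFinset (fun i => Finset.Icc (lo i) (hi i)), ∑ μ : Fin (F.P K).d, 192 * W * |δσ x μ| := hpush
    _ = 192 * W * ∑ x ∈ Fintype.piFinset (fun i => Finset.Icc (lo i) (hi i)), ∑ μ : Fin (F.P K).d, |δσ x μ| := by
        rw [Finset.mul_sum]; refine Finset.sum_congr rfl fun x _ => ?_; rw [Finset.mul_sum]
    _ ≤ 192 * (370440 * (C₁ + C₂) * M / R) * (370440 * (C₁ + C₂) * M / R) := by
        have h192 : 0 ≤ 192 * W := by positivity
        exact mul_le_mul (mul_le_mul_of_nonneg_left hWle (by norm_num)) hbox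
          (Finset.sum_nonneg fun _ _ => Finset.sum_nonneg fun _ _ => abs_nonneg _) (by positivity)
    _ = 192 * (370440 * (C₁ + C₂) * M / R) ^ 2 := by ring

/-- ★★★ **ROW (R7′) «COLLAR FLOOR», COLLAR MASS OVER `Q_{3R+2}(z₀)`** (v1.1 twin of `collarFloor_row_le` in the CORRECTED letter of the pen, skeleton v3.5: `δσ` is one more backward
difference of `σ = E₁ − C₂ ⊆ Q_{3R+1}`, hence lives in `Q_{3R+2}`): with `W = Σ_{y ∈ Q_{3R+2}(z₀)} Σ_ν |δσ y ν|`, `n = 6R + 6`, `M₀ ≤ 9(L²)^j`, `12·L^{3j} ≤ R` and the size rows of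
`sum_omega_le`: `(n:ℝ)·Σ_b ω b ≤ 9072·370440²·(C₁+C₂)²·(F.L)^j` (same constant). [cite: GrossCMP1983, Thm 2.2; Balaban1984PropagatorsII, (1.9) p.226] -/
theorem collarFloor_row_le' (F : T3Family) (K : ℕ) {lo hi : Fin (F.P K).d → ℤ} (hN : ∀ κ, hi κ - lo κ < (F.P K).sitesPerDir 0)
    {C₁ C₂ : ℝ} (hC₁ : 0 ≤ C₁) (hC₂ : 0 ≤ C₂)
    (hK1 : ∀ (e : Fin 3) (w : Zd 3) (n : ℕ), 1 ≤ n → w ∉ box (0 : Zd 3) ((n : ℤ) - 1) →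
      |latticeGreen (w + unitVec e) - latticeGreen w| ≤ C₁ / (n : ℝ) ^ 2)
    (hK2 : ∀ (e : Fin 3) (w : Zd 3) (n : ℕ), 2 ≤ n → w ∉ box (0 : Zd 3) ((n : ℤ) - 1) → ∀ i : Fin 3,
      |(latticeGreen (w + unitVec i + unitVec e) - latticeGreen (w + unitVec i)) - (latticeGreen (w + unitVec e) - latticeGreen w)| ≤ C₂ / (n : ℝ) ^ 3)
    {j : ℕ}
    (wt βt : Zd (F.P K).d → Fin (F.P K).d → Fin (F.P K).d → ℝ) (at' : Zd (F.P K).d → Fin (F.P K).d → ℝ)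
    (γt : Zd (F.P K).d → Fin (F.P K).d → Fin (F.P K).d → Fin (F.P K).d → ℝ)
    (z₀ : Zd (F.P K).d) (R₀ : ℕ)
    (hβt : ∀ x μ ν, βt x μ ν = ∑ y ∈ box z₀ (R₀ : ℤ), latticeGreen (x - y) / 2 * wt y μ ν)
    (hat : ∀ x ν, at' x ν = ∑ μ, (βt (x - unitVec μ) μ ν - βt x μ ν))
    (hγt : ∀ x κ μ ν, γt x κ μ ν =
      (βt (x + unitVec κ) μ ν - βt x μ ν) - (βt (x + unitVec μ) κ ν - βt x κ ν) + (βt (x + unitVec ν) κ μ - βt x κ μ))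
    (hM9 : ∑ μ, ∑ ν', ∑ y ∈ box z₀ (R₀ : ℤ), |wt y μ ν'| ≤ 9 * (((F.L : ℝ)) ^ 2) ^ j)
    (χ : Zd (F.P K).d → ℝ) (R : ℕ) (hχ1 : ∀ x ∈ box z₀ (R : ℤ), χ x = 1) (hχ0 : ∀ x, x ∉ box z₀ (3 * (R : ℤ)) → χ x = 0)
    (hχp : ∀ x (μ : Fin (F.P K).d), |χ (x + unitVec μ) - χ x| ≤ 2 / (R : ℝ))
    (hχm : ∀ x (μ : Fin (F.P K).d), |χ (x - unitVec μ) - χ x| ≤ 2 / (R : ℝ))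
    (hχ2 : ∀ x (κ μ : Fin (F.P K).d), |χ (x + unitVec κ + unitVec μ) - χ (x + unitVec κ) - χ (x + unitVec μ) + χ x| ≤ 4 / (R : ℝ) ^ 2)
    (E1 C2 σ : Zd (F.P K).d → Fin (F.P K).d → Fin (F.P K).d → ℝ) (δσ : Zd (F.P K).d → Fin (F.P K).d → ℝ)
    (hE1 : ∀ x μ ν, E1 x μ ν = (χ (x + unitVec μ) - χ x) * at' (x + unitVec μ) ν - (χ (x + unitVec ν) - χ x) * at' (x + unitVec ν) μ)
    (hC2 : ∀ x μ ν, C2 x μ ν = ∑ κ, (χ x - χ (x - unitVec κ)) * γt (x - unitVec κ) κ μ ν)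
    (hσ : ∀ x μ ν, σ x μ ν = E1 x μ ν - C2 x μ ν)
    (hδσ : ∀ y ν, δσ y ν = ∑ μ, (σ (y - unitVec μ) μ ν - σ y μ ν))
    (W : ℝ) (hW : W = ∑ y ∈ box z₀ (3 * (R : ℤ) + 2), ∑ ν, |δσ y ν|)
    (ω : PBond (F.P K) 0 → ℝ)
    (hω : ∀ (x : Fin (F.P K).d → ℤ) (μ : Fin (F.P K).d), lo ≤ x → x + e μ ≤ hi → ω ⟨castSite x, μ⟩ = 192 * W * |δσ x μ|)
    (hωoff : ∀ b : PBond (F.P K) 0, (¬ ∃ y : Fin (F.P K).d → ℤ, lo ≤ y ∧ y + e b.dir ≤ hi ∧ b.src = castSite y) → ω b = 0)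
    (n : ℕ) (hn : n = 6 * R + 6)
    (N : ℕ) (hN2 : 2 ≤ N) (hNR : (N : ℤ) + R₀ + 4 ≤ R) (hRN : R ≤ 2 * N) (hRL : 12 * F.L ^ (3 * j) ≤ R) :
    (n : ℝ) * ∑ b : PBond (F.P K) 0, ω b ≤ 9072 * 370440 ^ 2 * (C₁ + C₂) ^ 2 * (F.L : ℝ) ^ j := by
  have hL2 : 2 ≤ F.L := F.hL.2
  have hL1r : (1 : ℝ) ≤ (F.L : ℝ) := by exact_mod_cast le_trans (by norm_num) hL2
  have hR12 : 12 ≤ R := by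
    have h1 : 1 ≤ F.L ^ (3 * j) := Nat.one_le_pow _ _ (le_trans (by norm_num) hL2)
    have := Nat.mul_le_mul_left 12 h1
    omega
  have hM0 : (0 : ℝ) ≤ 9 * (((F.L : ℝ)) ^ 2) ^ j := by positivity
  have hω_le := sum_omega_le_of_eq_sum F K hN hC₁ hC₂ hK1 hK2 wt βt at' γt z₀ R₀ hβt hat hγt hM0 hM9 χ R hχ1 hχ0 hχp hχm hχ2 E1 C2 σ δσ hE1 hC2 hσ hδσ
    (box z₀ (3 * (R : ℤ) + 2)) W hW ω hω hωoff N hN2 hNR hRN (by omega)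
  have hn0 : (0 : ℝ) ≤ n := Nat.cast_nonneg n
  have hRr : (6 : ℝ) ≤ R := by exact_mod_cast (le_trans (by norm_num) hR12)
  have hRLr : 12 * (F.L : ℝ) ^ (3 * j) ≤ R := by exact_mod_cast hRL
  calc (n : ℝ) * ∑ b : PBond (F.P K) 0, ω b ≤ (n : ℝ) * (192 * (370440 * (C₁ + C₂) * (9 * (((F.L : ℝ)) ^ 2) ^ j) / R) ^ 2) :=
        mul_le_mul_of_nonneg_left hω_le hn0
    _ = (6 * (R : ℝ) + 6) * (192 * (370440 * (C₁ + C₂) * (9 * (((F.L : ℝ)) ^ 2) ^ j) / R) ^ 2) := by rw [hn]; push_cast; ring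
    _ ≤ 9072 * 370440 ^ 2 * (C₁ + C₂) ^ 2 * (F.L : ℝ) ^ j := row_arith hRr hM0 le_rfl hL1r hRLr

end Summit.QuantumFields.YangMills.Theorems.GrossTransferStubLinTestCollarFloorRow
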